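import Literature.AlgebraicGeometry.AbelianSchemes.AbelianSchemeQuotientDualPairRigidified
import Literature.AlgebraicGeometry.AbelianSchemes.AbelianSchemeQuotientPoincareSlices
import HarnessLib

/-!
# `(ψ × ψ̂)^*𝒫_B^{rig} ≅ ([n] × 1)^*𝒫` — the graph pull-back of the quotient's Poincaré sheaf (HECKE-LINK, (X-amp-1) input `hN`)

Layer `Literature/AlgebraicGeometry/AbelianSchemes`, namespace `Literature.AlgebraicGeometry.AbelianSchemes.AbelianSchemeOver`.
Cell `hodgecm-mathlib`, HECKE-LINK line card v1.2, B-p05 (g15)'s (X-amp-1) `exists_isLambdaOfAt_mul_self_of_graphPullback` binder `hN`,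
over ★ `AbelianSchemeQuotientDualPairRigidified` (p746606, B-p16: `𝒫_B^{rig}`, `(B ◁ ψ̂)^*𝒫_B^{rig} ≅ 𝒩₁`), ★ D0 (p742656: `ψ ≫ π = [n]`)
and ★ `AbelianSchemeQuotientPoincareSlices` (p746968: `baseChangeHom = whisker` on underlying maps).  [MumfordAV1970] §15 Thm. 1 (p. 143),
§23 (p. 231): for `B = A/K` with `ψ : A → B`, `ψ̂ : Â → B̂ = Â/K′`, the pull-back of the (rigidified) Poincaré sheaf of `B` along
`ψ × ψ̂ = (ψ ▷ Â) ≫ (B ◁ ψ̂)` is `([n]_A × 1_Â)^*𝒫`: `(ψ ▷ Â)^*(B ◁ ψ̂)^*𝒫_B^{rig} ≅ (ψ ▷ Â)^*(π ▷ Â)^*𝒫 = ((ψ ≫ π) ▷ Â)^*𝒫 =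
([n] ▷ Â)^*𝒫`.  ONE THEOREM (+ the two projection identities of `ψ × ψ̂`); no definition, no instance, no sorry.  HC_CM is proved only
modulo the 7 printed citations until rung 0 closes; nothing here is about HC.

## References
* [MumfordAV1970] D. Mumford, *Abelian Varieties* (1970), §15 Thm. 1 (p. 143), §23 (p. 231).
-/

noncomputable section

universe u

open CategoryTheory CategoryTheory.Limits AlgebraicGeometry MonoidalCategory CartesianMonoidalCategory
open scoped MonObj

namespace Literature.AlgebraicGeometry.AbelianSchemes

namespace AbelianSchemeOver

open Literature.AlgebraicGeometry.RelativeSpec Literature.AlgebraicGeometry.AbelianVarieties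
  Literature.AlgebraicGeometry.Motives Literature.AlgebraicGeometry.Modules

variable {S : Scheme.{u}} (A : AbelianSchemeOver S)
  {Y : Scheme.{u}} (u : S ⟶ Y) (K : Subgroup A.Sections) [IsCommMonObj A.X] {n : ℕ}
  (hK : ∀ σ : K, (σ : A.Sections) ^ n = 1)
  [Finite K] [Y.IsSeparated] [IsSeparated (A.X.hom ≫ u)] [S.IsSeparated]
  (hcov : ∀ x : A.left, ∃ O : (A.translationActionOver u K).StableAffineOpens, x ∈ O.1)
  [LocallyOfFiniteType (A.X.hom ≫ u)] [IsLocallyNoetherian Y]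
  (hG : ∃ _ : GrpObj (A.quotientOver u K), IsMonHom (A.quotientMk u K hcov))
  (hsm : Smooth (A.quotientOver u K).hom) (hgc : GeometricallyConnected (A.quotientOver u K).hom)
  (D : A.DualPair) [IsAffine Y]
  (hfree : ∀ (Ω : Type u) [Field Ω] [IsAlgClosed Ω] (x : Spec (.of Ω) ⟶ A.left) (σ : K), σ ≠ 1 →
    x ≫ (A.translation (σ : A.Sections)).left ≠ x)
  (K' : Subgroup D.hat.Sections) [Finite K'] [IsSeparated (D.hat.X.hom ≫ u)]
  (hcov' : ∀ x : D.hat.left, ∃ O : (D.hat.translationActionOver u K').StableAffineOpens, x ∈ O.1)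
  [LocallyOfFiniteType (D.hat.X.hom ≫ u)]
  (hG' : ∃ _ : GrpObj (D.hat.quotientOver u K'), IsMonHom (D.hat.quotientMk u K' hcov'))
  (hsm' : Smooth (D.hat.quotientOver u K').hom) (hgc' : GeometricallyConnected (D.hat.quotientOver u K').hom)
  (hfree' : ∀ (Ω : Type u) [Field Ω] [IsAlgClosed Ω] (x : Spec (.of Ω) ⟶ D.hat.left) (σ : K'), σ ≠ 1 →
    x ≫ (D.hat.translation (σ : D.hat.Sections)).left ≠ x)
  (Φ : (prodTranslationActionOver (A.quotientBy u K hcov hG hsm hgc) D.hat u K' hcov').EquivariantStructure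
    (A.poincarePullback u K hK hcov hG hsm hgc D hfree))

include hfree' in
/-- **`(ψ × ψ̂)^*𝒫_B^{rig} ≅ ([n] × 1)^*𝒫`**, with `ψ × ψ̂ := (ψ ▷ Â) ≫ (B ◁ ψ̂)` in `Over S` and `([n] × 1) := ([n]_A)_{Â}` (★ `baseChangeHom`)
— the `hN` input of (X-amp-1). [cite: MumfordAV1970, §15 Thm. 1 (p. 143)] [cite: MumfordAV1970, §23 (p. 231)] -/
theorem nonempty_pullback_whiskerRight_whiskerLeft_poincareQuotRigid_iso :
    Nonempty ((Scheme.Modules.pullback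
        (((A.quotientMk u K hcov : A.X ⟶ (A.quotientBy u K hcov hG hsm hgc).X) ▷ D.hat.X) ≫
          ((A.quotientBy u K hcov hG hsm hgc).X ◁
            (show D.hat.X ⟶ (D.hat.quotientBy u K' hcov' hG' hsm' hgc').X from D.hat.quotientMk u K' hcov'))).left).obj
        (A.poincareQuotRigid u K hK hcov hG hsm hgc D hfree K' hcov' hG' hsm' hgc' Φ) ≅
      (Scheme.Modules.pullback (baseChangeHom (A.mulN n) D.hat.X.hom).left).obj D.P) := by
  obtain ⟨e⟩ :=
    A.nonempty_pullback_whiskerLeft_poincareQuotRigid_iso u K hK hcov hG hsm hgc D hfree K' hcov' hG' hsm' hgc' hfree' Φ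
  -- `(π_{Â}).left = (π ▷ Â).left`, `([n]_{Â}).left = ([n] ▷ Â).left`, and `(ψ ▷ Â) ≫ (π ▷ Â) = [n] ▷ Â`
  have hπ := A.baseChangeHom_left_eq_whiskerRight_left D (A.quotientBy u K hcov hG hsm hgc) (A.mulNDesc u K hK hcov)
  have hn := A.baseChangeHom_left_eq_whiskerRight_left D A (A.mulN n)
  have hcomp : ((A.quotientMk u K hcov : A.X ⟶ (A.quotientBy u K hcov hG hsm hgc).X) ▷ D.hat.X).left ≫
      ((A.mulNDesc u K hK hcov : (A.quotientBy u K hcov hG hsm hgc).X ⟶ A.X) ▷ D.hat.X).left =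
        (A.mulN n ▷ D.hat.X).left := by
    rw [← Over.comp_left, ← comp_whiskerRight]
    exact congrArg (fun t => (t ▷ D.hat.X).left) (A.quotientMk_comp_mulNDesc u K hK hcov)
  refine ⟨((Scheme.Modules.pullbackComp _ _).app _).symm ≪≫ (Scheme.Modules.pullback _).mapIso e ≪≫ ?_⟩
  -- now at `(ψ ▷ Â)^* 𝒩₁` with `𝒩₁ = (π_{Â})^*𝒫`
  rw [show (A.poincarePullbackBundle u K hK hcov hG hsm hgc D hfree).L = A.poincarePullback u K hK hcov hG hsm hgc D hfree from rfl,
    poincarePullback_eq]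
  exact (Scheme.Modules.pullback _).mapIso ((Scheme.Modules.pullbackCongr hπ).app _) ≪≫
    (Scheme.Modules.pullbackComp _ _).app _ ≪≫ (Scheme.Modules.pullbackCongr (hcomp.trans hn.symm)).app _

end AbelianSchemeOver

end Literature.AlgebraicGeometry.AbelianSchemes

end
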